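import Mathlib
import Summits.Ventures.HodgeRepro2.Tier7.Line3.DoubleCosetCover
import Summits.Ventures.HodgeRepro2.Tier7.Line3.CartanDecomposition
import Summits.Ventures.HodgeRepro2.Tier7.Line3.CoverCountCartan

/-!
# Tier7/Line3/CoverCountCompact — the split-place box count over a COMPACT support: one constant of the support, for every `γ`

Filer: t7-L1-p3 (gen 9, prover-pub-hodge-repro2-t7-L1-p3-g9-0), self-selected SUPPORT row (TARGET l. 16138, amendments
ll. 16208 / 16213 / 16221). Lane: Line 3 SUPPORT, [M]-level; NOT a line, NOT a device; touches neither (a′) nor (b′).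

WHAT IT SUPPLIES — the end of the chain (A) → (B) → CosetEntryBounds → CoverCountCartan → CartanDecomposition:
* G1 `exists_finset_cartan_cover`: for `O = {x | v x ≤ 1}` open in the topological field `F` (`hO`, displayed as in
  DoubleCosetCover; `[IsTopologicalRing F]` is crit-1's (P1) l. 16132 — the `IsTopologicalGroup (GL (Fin 2) F)` instance
  that composes (A)(e) into (A)(a)–(d); at the model `F = w.adicCompletion K` the openness of `O` is a theorem of the
  Valued topology, in words until typed — plan-3 l. 16142 (4)) and `U ⊆ GL₂(F)` compact, finitely many CARTAN double cosets `K · diag(ϖ^{m_t}, ϖ^{n_t}) · K`,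
  `K = GL₂(O)`, cover `U` — DoubleCosetCover's `exists_finset_doubleCoset_cover` (compactness, `K` open by
  `isOpen_integralSubgroup`) composed with CartanDecomposition's `exists_mem_doubleCoset_diag` and
  `DoubleCoset.doubleCoset_eq_of_mem`;
* G2 `exists_finset_count_le_of_compact`: a finite `T` with Cartan data `(m_t, n_t)` DEPENDING ON `U` ONLY such that, for
  EVERY `γ = !![a, b; c, d]` with non-zero entries and determinant and all integers `M₁ ≥ e₁`, `M₂ ≥ e₂`, `M₁, M₂ ≥ 0`,
  `#(value pairs of the solutions of t⁻¹ γ s ∈ U) ≤ (∑_{t ∈ T} (1 + |m_t − n_t|)²) · (1 + M₁)(1 + M₂)`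
  (CoverCountCartan's `ncard_image_valuePair_sol_le_cartanCover_model` on the cover of G1); and
  `exists_const_count_le_of_compact`: ONE real `Cw ≥ 1` of the support with `(#value pairs : ℝ) ≤ Cw · (1 + M₁)(1 + M₂)` for
  every `γ` — SplitFactorConstants' `hCw1` and `hb` at one place as THEOREMS of `(F, v, ϖ, hO, U compact)`;
* G3 `exists_const_count_le_of_compact_valued`: on a field with Mathlib's `Valued F ℤᵐ⁰` structure (the valuation
  topology; the model `F = w.adicCompletion K`), `v := Valued.v`, the hypothesis `hO` is DISCHARGED by
  `Valued.isOpen_integer` (the closed unit ball is open; the `IsTopologicalRing` instance is `Valued`'s) — the per-place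
  constant is a theorem of `(F valued, ϖ, U compact)` alone; the model `F = w.adicCompletion K` carries the `Valued`
  instance with `Valued.v` the extended valuation (the real `hϖ` = x1's `valued_uniformizer_eq`). ONE topology: the Units
  topology of `GL (Fin 2) F` over the matrix (Pi) topology of the valuation topology, as in DoubleCosetCover;
* G4 ALL PLACES (crit-2 l. 16211 (P1)/(P3)): `count_le_of_subset_integral` — `U ⊆ K = GL₂(O)` gives the single-coset cover
  `K · 1 · K` (`1 = diag(ϖ^0, ϖ^0)`, cost `1`), so `Cw = 1` off `S` is a theorem of `U_w ⊆ K_w`; and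
  `exists_splitFactor_le_of_compact_supports`: per place a compact support `U w`, `U w ⊆ K_w` off a FINITE set (`hS`),
  the entries of every `γ` with `e₁ ≤ ord_w (I γ)`, `e₂ ≤ ord_w (J γ)`, and the displayed finite support of the counts ⇒
  ONE `C` with `splitFactor b γ ≤ C · (N(I γ) N(J γ))^ε` for all `γ` — CoverCountCartan's consumer E3 with `hCw1`, `hCwfin`
  AND `hb` all discharged (`Cw w := 1` off `S`, the G2 constant on `S`): no cover, no Cartan datum, no per-coset clause
  is displayed any more; `exists_splitFactor_le_of_compact_supports_valued` is its model form — every `F w` with the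
  `Valued` structure, `hO` and the topological-ring instances `Valued`'s theorems, so at the model only the uniformisers
  (`hϖ`), the compact supports with `hS`, the entries' clauses with `he₁ / he₂` and `hfin` remain displayed
  (crit-2 l. 16214 (b)); and `exists_splitFactor_le_of_compact_supports_adic` is THE ADIC MODEL — `F w := w.adicCompletion K`
  — where the uniformiser is a theorem too (`exists_uniformizer_adicCompletion`: Mathlib's `valuation_exists_uniformizer`
  through `valuedAdicCompletion_eq_valuation'`; plan-3 l. 16217 (1), crit-2 l. 16212 (ii)), so ONLY the compact supports
  with `hS`, the entries' clauses with `he₁ / he₂` and `hfin` are displayed. The displayed `hfin` is a DATUM sentence: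
  off `S` and the supports of `I γ`, `J γ` the count is `1` or `0`, so `hfin` says «the box at `γ` is non-empty at almost
  all places» — at the real data the unramified computation `b_w(γ) = 1` for almost all `w` (crit-2 l. 16214 (a),
  plan-3 l. 16217 (2)).
RE-INDEXING (crit-2 l. 16211 (P2)): G1 keeps (A)'s `T : Finset (GL (Fin 2) F)`, chooses per `t` the Cartan unit `D t` with
`t ∈ K (D t) K` (`doubleCoset_eq_of_mem`), and G2 passes the MATRIX IMAGE of the cover to CoverCountCartan's E1.

WHAT STAYS IN WORDS (the dictionary, (a′)): that the real support `U_w = supp f_w` is a compact (open) subset of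
`GL₂(F_w)` (for `F_w = w.adicCompletion K`, G4 (iv): `O_w` open AND the uniformiser are theorems, no longer in words —
plan-3 l. 16217 (1) strikes «`ϖ_w` the real uniformiser» from this list at the model); that `b w γ` IS `#(value pairs of
sol (entries of γ read at w) U_w)` for `γ` with all four entries non-zero at `w` (the binders `ha hb hc hd hdet` of G2 — degenerate `γ` are
outside the statements, the real sum's constant-term / identity-coset terms in words; crit-2 (P1)); the quantifier order
`∃ T m n` / `∃ Cw` BEFORE `∀ γ` is the content (crit-2 (P2)), and `0 ≤ M₁`, `0 ≤ M₂` are binders of the integer form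
(crit-2 (P3)); `e₁ ≤ ord_w (I γ)`, `e₂ ≤ ord_w (J γ)` for the numerator ideals of `κ(γ)`, `κ(γ) − 1`; the finiteness of
`S` (`hS`, displayed: `U_w ⊆ K_w` off a finite set — the real `f_w = 1_{K_w}` off `S`); the displayed finite support of the
counts (`hfin`); the place datum — and nothing else of the split-place table (plan-3 l. 16210 (3): its complete residue). Nothing here is about (N), (P), the real `X`, or
HC_CM. §8(d): NO. Blind lane: Mathlib + the HodgeRepro2 prefix; no sorry;
axioms ⊆ {propext, Classical.choice, Quot.sound}.
-/

namespace Summit.Ventures.HodgeRepro2.Tier7.Line3.CoverCountCompact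

open Matrix DoubleCoset WithZero Multiplicative Summit.Ventures.HodgeRepro2.Tier7.Line3.SplitOrbitBox
  Summit.Ventures.HodgeRepro2.Tier7.Line3.DoubleCosetCover
  Summit.Ventures.HodgeRepro2.Tier7.Line3.CartanDecomposition
  Summit.Ventures.HodgeRepro2.Tier7.Line3.CoverCountLink
  Summit.Ventures.HodgeRepro2.Tier7.Line3.CoverCountCartan

/-! ## G1. The Cartan cover of a compact set -/

section CartanCover

variable {F : Type*} [Field F] [TopologicalSpace F] [IsTopologicalRing F]
  (v : Valuation F (WithZero (Multiplicative ℤ))) (ϖ : F)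
  (hϖ : v ϖ = ((Multiplicative.ofAdd (-1 : ℤ) : Multiplicative ℤ) : WithZero (Multiplicative ℤ)))

include hϖ in
/-- **THE CARTAN COVER OF A COMPACT SET**: for `O = {x | v x ≤ 1}` open in `F` and `U ⊆ GL₂(F)` compact, finitely many
Cartan double cosets `K · diag(ϖ^{m_t}, ϖ^{n_t}) · K` (`K = GL₂(O)`, `t ∈ T`) cover `U` — DoubleCosetCover's
`exists_finset_doubleCoset_cover` (compactness) composed with the Cartan decomposition `exists_mem_doubleCoset_diag`
(every `K t K` is a `K · diag · K`, `doubleCoset_eq_of_mem`). -/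
theorem exists_finset_cartan_cover (hO : IsOpen (v.integer : Set F)) {U : Set (GL (Fin 2) F)}
    (hU : IsCompact U) :
    ∃ (T : Finset (GL (Fin 2) F)) (m n : GL (Fin 2) F → ℤ) (D : GL (Fin 2) F → GL (Fin 2) F),
      (∀ t, (D t : Matrix (Fin 2) (Fin 2) F) = diagonal ![ϖ ^ m t, ϖ ^ n t]) ∧
      U ⊆ ⋃ t ∈ T, doubleCoset (D t) (integralSubgroup v.integer : Set (GL (Fin 2) F))
        (integralSubgroup v.integer) := by
  obtain ⟨T, -, hcov⟩ := exists_finset_doubleCoset_cover (integralSubgroup v.integer)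
    (isOpen_integralSubgroup v.integer hO) hU
  choose m n D hD hmem using fun t : GL (Fin 2) F => exists_mem_doubleCoset_diag v ϖ hϖ t
  refine ⟨T, m, n, D, hD, hcov.trans ?_⟩
  refine Set.iUnion₂_mono fun t _ => ?_
  rw [doubleCoset_eq_of_mem (hmem t)]

end CartanCover

/-! ## G2. The split-place box count over a compact support: one constant of the support, for every `γ` -/

section Count

variable {F : Type*} [Field F] [TopologicalSpace F] [IsTopologicalRing F]
  (v : Valuation F (WithZero (Multiplicative ℤ))) (ϖ : F)
  (hϖ : v ϖ = ((Multiplicative.ofAdd (-1 : ℤ) : Multiplicative ℤ) : WithZero (Multiplicative ℤ)))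

include hϖ in
/-- **THE PER-PLACE CONSTANT FROM COMPACTNESS (integer form)**: for `U ⊆ GL₂(F)` compact there are a finite `T` and
Cartan data `(m_t, n_t)` — depending on `U` ONLY — such that for EVERY `γ = !![a, b; c, d]` (entries and determinant
non-zero) and integers `M₁ ≥ e₁`, `M₂ ≥ e₂`, `M₁, M₂ ≥ 0`,
`#(value pairs of the solutions of `t⁻¹ γ s ∈ U`) ≤ (∑_{t ∈ T} (1 + |m_t − n_t|)²) · (1 + M₁)(1 + M₂)`
(`exists_finset_cartan_cover` + CoverCountCartan's `ncard_image_valuePair_sol_le_cartanCover_model`). -/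
theorem exists_finset_count_le_of_compact (hO : IsOpen (v.integer : Set F)) {U : Set (GL (Fin 2) F)}
    (hU : IsCompact U) :
    ∃ (T : Finset (GL (Fin 2) F)) (m n : GL (Fin 2) F → ℤ), ∀ (a b c d : F)
      (ha : a ≠ 0) (hb : b ≠ 0) (hc : c ≠ 0) (hd : d ≠ 0) (hdet : a * d - b * c ≠ 0)
      (M₁ M₂ : ℤ) (_hM₁ : 0 ≤ M₁) (_hM₂ : 0 ≤ M₂)
      (_he₁ : ord ((Valuation.ne_zero_iff v).2 hdet) - ord ((Valuation.ne_zero_iff v).2 ha) -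
            ord ((Valuation.ne_zero_iff v).2 hd) ≤ M₁)
      (_he₂ : ord ((Valuation.ne_zero_iff v).2 hdet) - ord ((Valuation.ne_zero_iff v).2 hb) -
            ord ((Valuation.ne_zero_iff v).2 hc) ≤ M₂),
      ((valuePair v '' sol a b c d
          ((fun x : GL (Fin 2) F => (x : Matrix (Fin 2) (Fin 2) F)) '' U)).ncard : ℤ) ≤
        (∑ t ∈ T, (1 + |m t - n t|) ^ 2) * ((1 + M₁) * (1 + M₂)) := by
  obtain ⟨T, m, n, D, hD, hcov⟩ := exists_finset_cartan_cover v ϖ hϖ hO hU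
  refine ⟨T, m, n, fun a b c d ha hb hc hd hdet M₁ M₂ hM₁ hM₂ he₁ he₂ => ?_⟩
  refine ncard_image_valuePair_sol_le_cartanCover_model v ϖ hϖ a b c d ha hb hc hd hdet T D m n hD _ ?_
    M₁ M₂ hM₁ hM₂ he₁ he₂
  refine (Set.image_mono hcov).trans ?_
  rw [Set.image_iUnion₂]

include hϖ in
/-- **THE PER-PLACE CONSTANT FROM COMPACTNESS (real form = SplitFactorConstants' `hb` / `hCw1`)**: for `U` compact there
is ONE real `Cw ≥ 1` (a constant of the support) with `(#value pairs : ℝ) ≤ Cw · (1 + M₁)(1 + M₂)` for every `γ` and all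
naturals `M₁ ≥ e₁`, `M₂ ≥ e₂`. -/
theorem exists_const_count_le_of_compact (hO : IsOpen (v.integer : Set F)) {U : Set (GL (Fin 2) F)}
    (hU : IsCompact U) :
    ∃ Cw : ℝ, 1 ≤ Cw ∧ ∀ (a b c d : F)
      (ha : a ≠ 0) (hb : b ≠ 0) (hc : c ≠ 0) (hd : d ≠ 0) (hdet : a * d - b * c ≠ 0) (M₁ M₂ : ℕ)
      (_he₁ : ord ((Valuation.ne_zero_iff v).2 hdet) - ord ((Valuation.ne_zero_iff v).2 ha) -
            ord ((Valuation.ne_zero_iff v).2 hd) ≤ M₁)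
      (_he₂ : ord ((Valuation.ne_zero_iff v).2 hdet) - ord ((Valuation.ne_zero_iff v).2 hb) -
            ord ((Valuation.ne_zero_iff v).2 hc) ≤ M₂),
      ((valuePair v '' sol a b c d
          ((fun x : GL (Fin 2) F => (x : Matrix (Fin 2) (Fin 2) F)) '' U)).ncard : ℝ) ≤
        Cw * ((1 + (M₁ : ℝ)) * (1 + (M₂ : ℝ))) := by
  obtain ⟨T, m, n, h⟩ := exists_finset_count_le_of_compact v ϖ hϖ hO hU
  refine ⟨max (1 : ℝ) ((∑ t ∈ T, (1 + |m t - n t|) ^ 2 : ℤ) : ℝ), le_max_left _ _,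
    fun a b c d ha hb hc hd hdet M₁ M₂ he₁ he₂ => ?_⟩
  have hZ := h a b c d ha hb hc hd hdet M₁ M₂ (Nat.cast_nonneg _) (Nat.cast_nonneg _) he₁ he₂
  have hR : ((valuePair v '' sol a b c d
      ((fun x : GL (Fin 2) F => (x : Matrix (Fin 2) (Fin 2) F)) '' U)).ncard : ℝ) ≤
      ((∑ t ∈ T, (1 + |m t - n t|) ^ 2 : ℤ) : ℝ) * ((1 + (M₁ : ℝ)) * (1 + (M₂ : ℝ))) := by
    have := (Int.cast_le (R := ℝ)).2 hZ
    push_cast at this ⊢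
    exact this
  exact hR.trans (mul_le_mul_of_nonneg_right (le_max_right _ _) (by positivity))

end Count

/-! ## G3. The valued-field model: `O` open is a THEOREM of the `Valued` topology (`Valued.isOpen_integer`) -/

section ValuedModel

variable {F : Type*} [Field F] [hv : Valued F (WithZero (Multiplicative ℤ))]

/-- **THE PER-PLACE CONSTANT ON A VALUED FIELD**: for `F` carrying Mathlib's `Valued F ℤᵐ⁰` structure (the valuation
topology — the model `F = w.adicCompletion K` carries it with `Valued.v` = the extended valuation, so at the real place
`hϖ` is x1's InertLevelBase `valued_uniformizer_eq`, defeq to the `exp (−1)` form by `WithZero.exp_eq_coe_ofAdd`; plan-3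
l. 16210 (1)), `v := Valued.v`, and a uniformiser `ϖ`, the hypothesis `hO` of G2 is DISCHARGED by `Valued.isOpen_integer`
(the closed unit ball is open) with `Valued`'s `IsTopologicalRing` instance: for `U ⊆ GL₂(F)` compact there is ONE real
`Cw ≥ 1` of the support with `(#value pairs : ℝ) ≤ Cw · (1 + M₁)(1 + M₂)` for every `γ` with non-zero entries and
determinant and all naturals `M₁ ≥ e₁`, `M₂ ≥ e₂`. ONE TOPOLOGY throughout (plan-3 l. 16210 (2)): compactness is in
`GL (Fin 2) F` with the Units (`embedProduct`) topology over the Pi (matrix) topology of the valuation topology of `F` —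
the same instance as DoubleCosetCover's cover theorem and its `isOpen_integralSubgroup`, and as G1 / G2 above. -/
theorem exists_const_count_le_of_compact_valued (ϖ : F)
    (hϖ : (Valued.v ϖ : WithZero (Multiplicative ℤ)) =
      ((Multiplicative.ofAdd (-1 : ℤ) : Multiplicative ℤ) : WithZero (Multiplicative ℤ)))
    {U : Set (GL (Fin 2) F)} (hU : IsCompact U) :
    ∃ Cw : ℝ, 1 ≤ Cw ∧ ∀ (a b c d : F)
      (ha : a ≠ 0) (hb : b ≠ 0) (hc : c ≠ 0) (hd : d ≠ 0) (hdet : a * d - b * c ≠ 0) (M₁ M₂ : ℕ)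
      (_he₁ : ord ((Valuation.ne_zero_iff (Valued.v : Valuation F (WithZero (Multiplicative ℤ)))).2 hdet) -
            ord ((Valuation.ne_zero_iff (Valued.v : Valuation F (WithZero (Multiplicative ℤ)))).2 ha) -
            ord ((Valuation.ne_zero_iff (Valued.v : Valuation F (WithZero (Multiplicative ℤ)))).2 hd) ≤ M₁)
      (_he₂ : ord ((Valuation.ne_zero_iff (Valued.v : Valuation F (WithZero (Multiplicative ℤ)))).2 hdet) -
            ord ((Valuation.ne_zero_iff (Valued.v : Valuation F (WithZero (Multiplicative ℤ)))).2 hb) -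
            ord ((Valuation.ne_zero_iff (Valued.v : Valuation F (WithZero (Multiplicative ℤ)))).2 hc) ≤ M₂),
      ((valuePair (Valued.v : Valuation F (WithZero (Multiplicative ℤ))) '' sol a b c d
          ((fun x : GL (Fin 2) F => (x : Matrix (Fin 2) (Fin 2) F)) '' U)).ncard : ℝ) ≤
        Cw * ((1 + (M₁ : ℝ)) * (1 + (M₂ : ℝ))) :=
  exists_const_count_le_of_compact (Valued.v : Valuation F (WithZero (Multiplicative ℤ))) ϖ hϖ
    (Valued.isOpen_integer F) hU

end ValuedModel

/-! ## G4. All places: the split product with constants from compact supports (`hCwfin` discharged off `S`) -/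

section AllPlaces

open IsDedekindDomain IsDedekindDomain.HeightOneSpectrum NumberField Function
  Summit.Ventures.HodgeRepro2.Tier7.Line3.SplitFactorProduct
  Summit.Ventures.HodgeRepro2.Tier7.Line3.SplitFactorConstants
open scoped NumberField

variable {F : Type*} [Field F]

/-- **the single-coset cover** (crit-2 l. 16211 (P3)): if `U ⊆ K = GL₂(O)`, the cover by the one double coset
`K · 1 · K` (`1 = diag(ϖ^0, ϖ^0)`, cost `(1 + |0 − 0|)² = 1`) gives `(#value pairs : ℝ) ≤ 1 · (1 + M₁)(1 + M₂)` — the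
value `Cw = 1` off `S` as a theorem of `U_w ⊆ K_w`. -/
theorem count_le_of_subset_integral (v : Valuation F (WithZero (Multiplicative ℤ))) (ϖ : F)
    (hϖ : v ϖ = ((Multiplicative.ofAdd (-1 : ℤ) : Multiplicative ℤ) : WithZero (Multiplicative ℤ)))
    {U : Set (GL (Fin 2) F)} (hUK : U ⊆ (integralSubgroup v.integer : Set (GL (Fin 2) F)))
    (a b c d : F) (ha : a ≠ 0) (hb : b ≠ 0) (hc : c ≠ 0) (hd : d ≠ 0) (hdet : a * d - b * c ≠ 0) (M₁ M₂ : ℕ)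
    (he₁ : ord ((Valuation.ne_zero_iff v).2 hdet) - ord ((Valuation.ne_zero_iff v).2 ha) -
            ord ((Valuation.ne_zero_iff v).2 hd) ≤ M₁)
    (he₂ : ord ((Valuation.ne_zero_iff v).2 hdet) - ord ((Valuation.ne_zero_iff v).2 hb) -
            ord ((Valuation.ne_zero_iff v).2 hc) ≤ M₂) :
    ((valuePair v '' sol a b c d
        ((fun x : GL (Fin 2) F => (x : Matrix (Fin 2) (Fin 2) F)) '' U)).ncard : ℝ) ≤
      1 * ((1 + (M₁ : ℝ)) * (1 + (M₂ : ℝ))) := by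
  have hg : ∀ _j : Unit, ((1 : GL (Fin 2) F) : Matrix (Fin 2) (Fin 2) F) =
      diagonal ![ϖ ^ (0 : ℤ), ϖ ^ (0 : ℤ)] := by
    intro _
    rw [Units.val_one, zpow_zero]
    ext i j
    fin_cases i <;> fin_cases j <;> simp [diagonal]
  have hcov : (fun x : GL (Fin 2) F => (x : Matrix (Fin 2) (Fin 2) F)) '' U ⊆
      ⋃ j ∈ (Finset.univ : Finset Unit), (fun x : GL (Fin 2) F => (x : Matrix (Fin 2) (Fin 2) F)) ''
        doubleCoset (1 : GL (Fin 2) F) (integralSubgroup v.integer : Set (GL (Fin 2) F))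
          (integralSubgroup v.integer) := by
    rintro _ ⟨x, hx, rfl⟩
    refine Set.mem_iUnion₂.2 ⟨(), Finset.mem_univ _, x, ?_, rfl⟩
    exact mem_doubleCoset.2 ⟨x, hUK hx, 1, (integralSubgroup v.integer).one_mem, by simp⟩
  have h := ncard_image_valuePair_sol_le_cartanCover_model v ϖ hϖ a b c d ha hb hc hd hdet
    (Finset.univ : Finset Unit) (fun _ => 1) (fun _ => 0) (fun _ => 0) hg _ hcov M₁ M₂
    (Nat.cast_nonneg _) (Nat.cast_nonneg _) he₁ he₂
  simp only [sub_zero, abs_zero, add_zero, one_pow, Finset.sum_const, Finset.card_univ, Fintype.card_unit,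
    one_smul] at h
  have := (Int.cast_le (R := ℝ)).2 h
  push_cast at this ⊢
  linarith

variable {K : Type*} [Field K] [NumberField K] {Orb : Type*}

/-- **THE SPLIT PRODUCT WITH CONSTANTS FROM COMPACT SUPPORTS, ALL PLACES** (crit-2 l. 16211 (P1)/(P3)): per place `w` a
field `F w` with its topology, `v w`, a uniformiser `ϖ w`, `O_w` open (`hO`), a compact support `U w ⊆ GL₂(F w)`, and
`U w ⊆ K_w = GL₂(O_w)` OFF A FINITE SET `S` (`hS`); for every `γ` the entries of `γ` read in `F w` (non-zero with
non-zero determinant) with `e₁ ≤ ord_w (I γ)`, `e₂ ≤ ord_w (J γ)`; and the displayed finite support of the counts: then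
ONE constant `C` has `splitFactor b γ ≤ C · (N(I γ) · N(J γ))^ε` for all `γ`, `b w γ := #(value pairs)` — CoverCountCartan's
consumer E3 with `Cw w := 1` off `S` (the single-coset cover, `count_le_of_subset_integral`) and `Cw w :=` the compact
support's constant of G2 on `S`, so `hCw1`, `hCwfin` AND `hb` are all discharged: no cover, no Cartan data, no per-coset
clause is displayed any more. The family `Cw` (a classical `ite` over the chosen G2 constants) lives INSIDE the proof —
nothing of it is displayed; `1 ≤ Cw w` holds in both branches (crit-2 l. 16214 (c)). THE DISPLAYED `hfin` IS A DATUM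
SENTENCE, not bookkeeping (crit-2 l. 16214 (a)): off `S` and the supports of `I γ`, `J γ` the count is `≤ 1`, i.e. `1` or
`0`, and `0` exactly where the solution set at `γ` is EMPTY — so `hfin` says «the box at `γ` is NON-EMPTY at almost all
places» (the real datum's `γ ∈ T_A(F) K_w T_B(F)` for almost all `w`). -/
theorem exists_splitFactor_le_of_compact_supports (I J : Orb → Ideal (𝓞 K)) {ε : ℝ} (hε : 0 < ε)
    (hI : ∀ γ, I γ ≠ ⊥) (hJ : ∀ γ, J γ ≠ ⊥)
    (F : HeightOneSpectrum (𝓞 K) → Type*) [∀ w, Field (F w)] [∀ w, TopologicalSpace (F w)]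
    [∀ w, IsTopologicalRing (F w)]
    (v : ∀ w, Valuation (F w) (WithZero (Multiplicative ℤ))) (ϖ : ∀ w, F w)
    (hϖ : ∀ w, v w (ϖ w) = ((Multiplicative.ofAdd (-1 : ℤ) : Multiplicative ℤ) : WithZero (Multiplicative ℤ)))
    (hO : ∀ w, IsOpen ((v w).integer : Set (F w)))
    (U : ∀ w, Set (GL (Fin 2) (F w))) (hU : ∀ w, IsCompact (U w))
    (hS : {w | ¬ U w ⊆ (integralSubgroup (v w).integer : Set (GL (Fin 2) (F w)))}.Finite)
    (a b c d : ∀ w, Orb → F w)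
    (ha : ∀ w γ, a w γ ≠ 0) (hb : ∀ w γ, b w γ ≠ 0) (hc : ∀ w γ, c w γ ≠ 0) (hd : ∀ w γ, d w γ ≠ 0)
    (hdet : ∀ w γ, a w γ * d w γ - b w γ * c w γ ≠ 0)
    (he₁ : ∀ w γ, ord ((Valuation.ne_zero_iff (v w)).2 (hdet w γ)) - ord ((Valuation.ne_zero_iff (v w)).2 (ha w γ)) -
            ord ((Valuation.ne_zero_iff (v w)).2 (hd w γ)) ≤ (multiplicity w.asIdeal (I γ) : ℤ))
    (he₂ : ∀ w γ, ord ((Valuation.ne_zero_iff (v w)).2 (hdet w γ)) - ord ((Valuation.ne_zero_iff (v w)).2 (hb w γ)) -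
            ord ((Valuation.ne_zero_iff (v w)).2 (hc w γ)) ≤ (multiplicity w.asIdeal (J γ) : ℤ))
    (hfin : ∀ γ, (mulSupport fun w => ((valuePair (v w) '' sol (a w γ) (b w γ) (c w γ) (d w γ)
      ((fun x : GL (Fin 2) (F w) => (x : Matrix (Fin 2) (Fin 2) (F w))) '' U w)).ncard : ℝ)).Finite) :
    ∃ C : ℝ, 0 < C ∧ ∀ γ,
      splitFactor (fun w γ => (valuePair (v w) '' sol (a w γ) (b w γ) (c w γ) (d w γ)
        ((fun x : GL (Fin 2) (F w) => (x : Matrix (Fin 2) (Fin 2) (F w))) '' U w)).ncard) γ ≤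
        C * ((Ideal.absNorm (I γ) : ℝ) * Ideal.absNorm (J γ)) ^ ε := by
  classical
  choose Cw' hCw'1 hb' using fun w => exists_const_count_le_of_compact (v w) (ϖ w) (hϖ w) (hO w) (hU w)
  let Cw : HeightOneSpectrum (𝓞 K) → ℝ := fun w =>
    if U w ⊆ (integralSubgroup (v w).integer : Set (GL (Fin 2) (F w))) then 1 else Cw' w
  have hCw1 : ∀ w, 1 ≤ Cw w := fun w => by
    by_cases h : U w ⊆ (integralSubgroup (v w).integer : Set (GL (Fin 2) (F w)))
    · simp [Cw, h]
    · simp [Cw, h, hCw'1 w]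
  have hCwfin : (mulSupport Cw).Finite := by
    refine hS.subset fun w hw => ?_
    intro h
    apply hw
    simp [Cw, h]
  refine exists_splitFactor_le_const _ I J hε hI hJ hfin Cw hCw1 hCwfin fun w γ => ?_
  by_cases h : U w ⊆ (integralSubgroup (v w).integer : Set (GL (Fin 2) (F w)))
  · have := count_le_of_subset_integral (v w) (ϖ w) (hϖ w) h (a w γ) (b w γ) (c w γ) (d w γ) (ha w γ) (hb w γ)
      (hc w γ) (hd w γ) (hdet w γ) (multiplicity w.asIdeal (I γ)) (multiplicity w.asIdeal (J γ)) (he₁ w γ) (he₂ w γ)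
    simpa [Cw, h] using this
  · have := hb' w (a w γ) (b w γ) (c w γ) (d w γ) (ha w γ) (hb w γ) (hc w γ) (hd w γ) (hdet w γ)
      (multiplicity w.asIdeal (I γ)) (multiplicity w.asIdeal (J γ)) (he₁ w γ) (he₂ w γ)
    simpa [Cw, h] using this

/-- **THE MODEL FORM** (crit-2 l. 16214 (b)): every `F w` with Mathlib's `Valued (F w) ℤᵐ⁰` structure (the model
`F w = w.adicCompletion K`), `v w := Valued.v`; the openness `hO w` and the topological-ring instances are `Valued`'s
theorems (`Valued.isOpen_integer`), so only the uniformisers `ϖ w` (`hϖ`), the compact supports `U w` with `hS`, the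
entries' clauses with `he₁ / he₂`, and `hfin` remain displayed. -/
theorem exists_splitFactor_le_of_compact_supports_valued (I J : Orb → Ideal (𝓞 K)) {ε : ℝ} (hε : 0 < ε)
    (hI : ∀ γ, I γ ≠ ⊥) (hJ : ∀ γ, J γ ≠ ⊥)
    (F : HeightOneSpectrum (𝓞 K) → Type*) [∀ w, Field (F w)] [∀ w, Valued (F w) (WithZero (Multiplicative ℤ))]
    (ϖ : ∀ w, F w)
    (hϖ : ∀ w, (Valued.v (ϖ w) : WithZero (Multiplicative ℤ)) =
      ((Multiplicative.ofAdd (-1 : ℤ) : Multiplicative ℤ) : WithZero (Multiplicative ℤ)))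
    (U : ∀ w, Set (GL (Fin 2) (F w))) (hU : ∀ w, IsCompact (U w))
    (hS : {w | ¬ U w ⊆ (integralSubgroup (Valued.v : Valuation (F w) (WithZero (Multiplicative ℤ))).integer :
      Set (GL (Fin 2) (F w)))}.Finite)
    (a b c d : ∀ w, Orb → F w)
    (ha : ∀ w γ, a w γ ≠ 0) (hb : ∀ w γ, b w γ ≠ 0) (hc : ∀ w γ, c w γ ≠ 0) (hd : ∀ w γ, d w γ ≠ 0)
    (hdet : ∀ w γ, a w γ * d w γ - b w γ * c w γ ≠ 0)
    (he₁ : ∀ w γ, ord ((Valuation.ne_zero_iff (Valued.v : Valuation (F w) (WithZero (Multiplicative ℤ)))).2 (hdet w γ)) -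
            ord ((Valuation.ne_zero_iff (Valued.v : Valuation (F w) (WithZero (Multiplicative ℤ)))).2 (ha w γ)) -
            ord ((Valuation.ne_zero_iff (Valued.v : Valuation (F w) (WithZero (Multiplicative ℤ)))).2 (hd w γ)) ≤
              (multiplicity w.asIdeal (I γ) : ℤ))
    (he₂ : ∀ w γ, ord ((Valuation.ne_zero_iff (Valued.v : Valuation (F w) (WithZero (Multiplicative ℤ)))).2 (hdet w γ)) -
            ord ((Valuation.ne_zero_iff (Valued.v : Valuation (F w) (WithZero (Multiplicative ℤ)))).2 (hb w γ)) -
            ord ((Valuation.ne_zero_iff (Valued.v : Valuation (F w) (WithZero (Multiplicative ℤ)))).2 (hc w γ)) ≤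
              (multiplicity w.asIdeal (J γ) : ℤ))
    (hfin : ∀ γ, (mulSupport fun w => ((valuePair (Valued.v : Valuation (F w) (WithZero (Multiplicative ℤ))) ''
      sol (a w γ) (b w γ) (c w γ) (d w γ)
      ((fun x : GL (Fin 2) (F w) => (x : Matrix (Fin 2) (Fin 2) (F w))) '' U w)).ncard : ℝ)).Finite) :
    ∃ C : ℝ, 0 < C ∧ ∀ γ,
      splitFactor (fun w γ => (valuePair (Valued.v : Valuation (F w) (WithZero (Multiplicative ℤ))) ''
        sol (a w γ) (b w γ) (c w γ) (d w γ)
        ((fun x : GL (Fin 2) (F w) => (x : Matrix (Fin 2) (Fin 2) (F w))) '' U w)).ncard) γ ≤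
        C * ((Ideal.absNorm (I γ) : ℝ) * Ideal.absNorm (J γ)) ^ ε :=
  exists_splitFactor_le_of_compact_supports I J hε hI hJ F
    (fun w => (Valued.v : Valuation (F w) (WithZero (Multiplicative ℤ)))) ϖ hϖ
    (fun w => Valued.isOpen_integer (F w)) U hU hS a b c d ha hb hc hd hdet he₁ he₂ hfin

/-- **a uniformiser of the adic completion exists** (plan-3 l. 16217 (1), crit-2 l. 16212 (ii)): Mathlib's
`valuation_exists_uniformizer` transported to `w.adicCompletion K` by `valuedAdicCompletion_eq_valuation'`. -/
theorem exists_uniformizer_adicCompletion (w : HeightOneSpectrum (𝓞 K)) :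
    ∃ ϖ : w.adicCompletion K, (Valued.v ϖ : WithZero (Multiplicative ℤ)) =
      ((Multiplicative.ofAdd (-1 : ℤ) : Multiplicative ℤ) : WithZero (Multiplicative ℤ)) := by
  obtain ⟨π, hπ⟩ := w.valuation_exists_uniformizer K
  exact ⟨(π : w.adicCompletion K), by rw [valuedAdicCompletion_eq_valuation', hπ]; rfl⟩

/-- **THE ADIC MODEL** (plan-3 l. 16217 (1)/(3)): at `F w := w.adicCompletion K` (Mathlib's `Valued` completion of `K` at
`w`) the uniformiser, the openness of `O_w` and the topological-ring instance are ALL theorems — only the compact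
supports `U w` with `hS`, the entries' clauses with `he₁ / he₂`, and `hfin` (the box non-empty at almost all places) are
displayed. SPELLING (plan-3 l. 16223 (1), crit-2 l. 16222 (i)): every `hϖ` of this chain — CartanDecomposition's,
CosetEntryBounds', CoverCountCartan's and G1–G4's — is the one term `↑(Multiplicative.ofAdd (−1 : ℤ))` in the codomain
`WithZero (Multiplicative ℤ)` (= `WithZero.exp (−1)` by `rfl`), so (iv)'s witness feeds (iii) by `exact`. ONE VALUATION
(crit-2 l. 16222 (ii)): this `Valued.v` on `w.adicCompletion K` is the same valuation x1's AdicCompletionLevel (p705534)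
reads its level tower through (`‖·‖ = (q w)^{−ord}`, `valued_coe_le_pow_iff` / `normAbv`), so the split row's `b w γ`
and the b-side's level are at ONE valuation; the compactness of `U w ⊆ GL₂(w.adicCompletion K)` is in the Units topology
of that `Valued` instance. -/
theorem exists_splitFactor_le_of_compact_supports_adic (I J : Orb → Ideal (𝓞 K)) {ε : ℝ} (hε : 0 < ε)
    (hI : ∀ γ, I γ ≠ ⊥) (hJ : ∀ γ, J γ ≠ ⊥)
    (U : ∀ w : HeightOneSpectrum (𝓞 K), Set (GL (Fin 2) (w.adicCompletion K))) (hU : ∀ w, IsCompact (U w))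
    (hS : {w : HeightOneSpectrum (𝓞 K) | ¬ U w ⊆ (integralSubgroup
      (Valued.v : Valuation (w.adicCompletion K) (WithZero (Multiplicative ℤ))).integer :
      Set (GL (Fin 2) (w.adicCompletion K)))}.Finite)
    (a b c d : ∀ w : HeightOneSpectrum (𝓞 K), Orb → w.adicCompletion K)
    (ha : ∀ w γ, a w γ ≠ 0) (hb : ∀ w γ, b w γ ≠ 0) (hc : ∀ w γ, c w γ ≠ 0) (hd : ∀ w γ, d w γ ≠ 0)
    (hdet : ∀ w γ, a w γ * d w γ - b w γ * c w γ ≠ 0)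
    (he₁ : ∀ w γ, ord ((Valuation.ne_zero_iff
              (Valued.v : Valuation (w.adicCompletion K) (WithZero (Multiplicative ℤ)))).2 (hdet w γ)) -
            ord ((Valuation.ne_zero_iff
              (Valued.v : Valuation (w.adicCompletion K) (WithZero (Multiplicative ℤ)))).2 (ha w γ)) -
            ord ((Valuation.ne_zero_iff
              (Valued.v : Valuation (w.adicCompletion K) (WithZero (Multiplicative ℤ)))).2 (hd w γ)) ≤
              (multiplicity w.asIdeal (I γ) : ℤ))
    (he₂ : ∀ w γ, ord ((Valuation.ne_zero_iff
              (Valued.v : Valuation (w.adicCompletion K) (WithZero (Multiplicative ℤ)))).2 (hdet w γ)) -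
            ord ((Valuation.ne_zero_iff
              (Valued.v : Valuation (w.adicCompletion K) (WithZero (Multiplicative ℤ)))).2 (hb w γ)) -
            ord ((Valuation.ne_zero_iff
              (Valued.v : Valuation (w.adicCompletion K) (WithZero (Multiplicative ℤ)))).2 (hc w γ)) ≤
              (multiplicity w.asIdeal (J γ) : ℤ))
    (hfin : ∀ γ, (mulSupport fun w : HeightOneSpectrum (𝓞 K) =>
      ((valuePair (Valued.v : Valuation (w.adicCompletion K) (WithZero (Multiplicative ℤ))) ''
        sol (a w γ) (b w γ) (c w γ) (d w γ)
        ((fun x : GL (Fin 2) (w.adicCompletion K) => (x : Matrix (Fin 2) (Fin 2) (w.adicCompletion K))) ''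
          U w)).ncard : ℝ)).Finite) :
    ∃ C : ℝ, 0 < C ∧ ∀ γ,
      splitFactor (fun (w : HeightOneSpectrum (𝓞 K)) γ =>
        (valuePair (Valued.v : Valuation (w.adicCompletion K) (WithZero (Multiplicative ℤ))) ''
          sol (a w γ) (b w γ) (c w γ) (d w γ)
          ((fun x : GL (Fin 2) (w.adicCompletion K) => (x : Matrix (Fin 2) (Fin 2) (w.adicCompletion K))) ''
            U w)).ncard) γ ≤
        C * ((Ideal.absNorm (I γ) : ℝ) * Ideal.absNorm (J γ)) ^ ε :=
  exists_splitFactor_le_of_compact_supports_valued I J hε hI hJ (fun w => w.adicCompletion K)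
    (fun w => Classical.choose (exists_uniformizer_adicCompletion w))
    (fun w => Classical.choose_spec (exists_uniformizer_adicCompletion w))
    U hU hS a b c d ha hb hc hd hdet he₁ he₂ hfin

end AllPlaces

end Summit.Ventures.HodgeRepro2.Tier7.Line3.CoverCountCompact
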